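import Summits.ResolutionOfSingularities.ResolutionOfSingularities.Theorems.PurelyInseparableDim4ResConeThreeWeights
import Summits.ResolutionOfSingularities.ResolutionOfSingularities.Theorems.PurelyInseparableDim4ResConeLossyTiltFreePeel
import Summits.ResolutionOfSingularities.ResolutionOfSingularities.Theorems.PurelyInseparableDim4PhiLineStepLaws
import Summits.ResolutionOfSingularities.ResolutionOfSingularities.Theorems.PurelyInseparableDim4PhiLinePolygon
import HarnessLib
import HarnessLib.Audit.Tags

/-!
# Purely inseparable four-folds — FRAME BOOKKEEPING for the B∞ assembly at `(p, d) = (5, 3)`: the residual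
# factorisations the Φ-line step laws consume, and the linear algebra of step / arrival frames
# (K2(p) lane, slice C `(5,3)`, memo §17 (R4); cell `res-dim4-pi`)

[OURS · counted 0 · cell `res-dim4-pi` · K2(p) lane holder res-dim4-p-12 g4's memo §17 / HOLDER WORD g4-2 and the HOME-only
skeleton `BInf-ASSEMBLY-SKELETON.lean` (0ca6362e9115b529): the assembly `no_bInf_tail_three_five_of_stubs` is the holder's and is
proved modulo three stubs `stub_entry` / `stub_keep` / `stub_lose`; this file is the COMMON BASE of their discharge — seat
res-dim4-p-9 g4.]  Nothing here proves K2(p)/K2(5), `NoIsolatedTrap p p`, the β_h line, or resolution of singularities in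
dimension ≥ 4 / characteristic `p`.  AI kernel work, weaker than expert review.

What every stub needs and none of R1 (res-dim4-p-11, `label_step`) / R2 (res-dim4-p-7, `u₂` re-choice) / R3 (res-dim4-p-2,
translated LOSE law) supplies:
* §1 **`bInf_factorisation`** — on TAIL-B data (isolated witnessed `Step0 5` chain, `x^{r₀} ∣ F₀`, off the floor, shade `3`
  from `k₀`): `(c k).F = x^{r_k} · G_k` with `G_k := (c k).F.divMonomial (c k).r`, `ord₀ G_k = 3`, `5 ≤ |r_k| + 3` — the
  `hF/hd/hp` binders of `PhiLine.betaS_step_lt_of_keep` / `betaS_step_le_of_lose`;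
* §2 **`bInf_step_factorisation`** — the `hF′/hd′` binders: `(step 5 univ (j k) (b k) (c k)).F = x^{(r_k|_{b_k = 0}).update
  (j k) (|r_k| + 3 − 5)} · G_{k+1}` with `3 ≤ ord₀ G_{k+1}` (W's `three_weights_laws` + `…LossyTiltFreePeel.eq_monomial_mul_divMonomial`);
* §3 LINEAR ALGEBRA OF FRAMES (rows `L : Fin (2+2) → Fin 4 → K`, left inverse `M`): **`arrival_left_inverse`** (dropping the
  pivot letter's coefficient from the non-pivot rows keeps a left inverse, EXPLICIT: `M′ t i = if i = piv then δ_{t m} else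
  M t i`), **`replaceRow_left_inverse`** (replacing the row `piv` by a linear form `v = Σ_i a_i L_i` with `a_piv ≠ 0` keeps a
  left inverse, explicit), `coeff_replaceRow_ne_zero` (`a_piv ≠ 0` as soon as the other rows kill a vector `w` with
  `v·w ≠ 0` — the direction of the step), **`twist_left_inverse`** (`ũ₂ = u₂ − λu₁`);
* §4 the frame read in `𝒪 = K[x]_{(x)}`: `frameRow_single` (`e_h ↦ x_h/1`), `frameRow_twist` (the twisted frame IS
  `WeightedOrder.u2Shear` of the old one with `lam = −λ/1`), `frameRow_sub_smul`.
All statements def-free (the skeleton's `frameOf` / `resIdeal` / `RunInv` unfolded); any field (no characteristic hypothesis).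
[cite: CossartJannsenSaito2020, Def. 8.2, Lemma 13.4 (3), Lemma 13.6] [cite: Hauser2010, §F (setting f = x^p + y^r g)]
bears_on: LADDER-RESOLUTION:D157-DOOR2 (res-dim4-pi · K2(p) · slice C (5,3) B∞ assembly, frames).  Supports
stmt-ResolutionOfSingularities-16155 (helper).
-/

set_option linter.dupNamespace false -- mandated namespace of this single-conjunct summit

noncomputable section

namespace Summit.ResolutionOfSingularities.ResolutionOfSingularities.Theorems.PIDim4

namespace ResCone

open MvPolynomial Finset IsLocalRing
open Literature.AlgebraicGeometry.Resolution
open Literature.AlgebraicGeometry.Resolution.CentreBlowup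
open Literature.AlgebraicGeometry.Resolution.Hauser2010
open Literature.AlgebraicGeometry.Resolution.HauserPerlega2019
open Literature.AlgebraicGeometry.Resolution.WeightedOrder

variable {K : Type} [Field K]

/-! ## 1. The residual factorisation at a shade-3 state -/

section Factorisation

variable [DecidableEq K]

/-- **`x^r · G` with `ord₀ G = 3` at every state of a shade-3 tail.**  On TAIL-B data (isolated witnessed `Step0 5` chain,
`x^{r₀} ∣ F₀`, off the floor, shade `3` from `k₀`), for `k ≥ k₀`: `(c k).F = x^{r_k} · G_k` with
`G_k = (c k).F.divMonomial (c k).r`, `ord₀ G_k = 3`, and `5 ≤ |r_k| + 3` — the `hF/hd/hp` binders of the Φ-line step laws.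
[OURS · bookkeeping] [cite: Hauser2010, §F (setting f = x^p + y^r g)] -/
theorem bInf_factorisation {c : ℕ → State K} {j : ℕ → Fin 4} {b : ℕ → Fin 4 → K}
    (hc : ∀ k, IsIsolated 5 (c k).F ∧ Step0 5 (c k) (c (k + 1))) (hw : FreeTail.IsWitnessedChain 5 c j b)
    (hr0 : ∀ e ∈ (c 0).F.support, (c 0).r ≤ e) (hfloor : ∀ k, ordZero (c k).F ≠ 5) {k₀ : ℕ}
    (hshade : ∀ k, k₀ ≤ k → (c k).shade = ((3 : ℕ) : ℕ∞)) {k : ℕ} (hk : k₀ ≤ k) :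
    (c k).F = monomial (c k).r 1 * (c k).F.divMonomial (c k).r ∧
      ordZero ((c k).F.divMonomial (c k).r) = (3 : ℕ) ∧ 5 ≤ (c k).r.degree + 3 ∧
      (∀ e ∈ (c k).F.support, (c k).r ≤ e) := by
  obtain ⟨hord, -, -, hfl, -⟩ := three_weights_laws hc hw hr0 hfloor hshade
  have hrk := IsolatedBand.isolated_chain_forall_le hc hr0 k
  have hF : (c k).F = monomial (c k).r 1 * (c k).F.divMonomial (c k).r := eq_monomial_mul_divMonomial hrk
  refine ⟨hF, ?_, by have := hfl k hk; omega, hrk⟩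
  have h1 := hord k hk
  rw [hF, PhiLine.ordZero_monomial_one_mul, Nat.cast_add] at h1
  exact (add_right_inj_of_ne_top (ENat.coe_ne_top _)).mp h1

/-- **The step factorisation** (`hF′/hd′` of the Φ-line step laws): for `k ≥ k₀` on TAIL-B data,
`(step 5 univ (j k) (b k) (c k)).F = x^{(r_k|_{b_k = 0}).update (j k) (|r_k| + 3 − 5)} · G_{k+1}` with
`G_{k+1} = (c (k+1)).F.divMonomial (c (k+1)).r` and `3 ≤ ord₀ G_{k+1}`. [OURS · bookkeeping]
[cite: Hauser2010, §F (setting f = x^p + y^r g)] -/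
theorem bInf_step_factorisation {c : ℕ → State K} {j : ℕ → Fin 4} {b : ℕ → Fin 4 → K}
    (hc : ∀ k, IsIsolated 5 (c k).F ∧ Step0 5 (c k) (c (k + 1))) (hw : FreeTail.IsWitnessedChain 5 c j b)
    (hr0 : ∀ e ∈ (c 0).F.support, (c 0).r ≤ e) (hfloor : ∀ k, ordZero (c k).F ≠ 5) {k₀ : ℕ}
    (hshade : ∀ k, k₀ ≤ k → (c k).shade = ((3 : ℕ) : ℕ∞)) {k : ℕ} (hk : k₀ ≤ k) :
    (CentreBlowup.step 5 Finset.univ (j k) (b k) (c k)).F =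
        monomial ((((c k).r.filter fun i => b k i = 0)).update (j k) ((c k).r.degree + 3 - 5)) 1 *
          (c (k + 1)).F.divMonomial (c (k + 1)).r ∧
      ((3 : ℕ) : ℕ∞) ≤ ordZero ((c (k + 1)).F.divMonomial (c (k + 1)).r) := by
  obtain ⟨-, hlaw, -, -, -⟩ := three_weights_laws hc hw hr0 hfloor hshade
  obtain ⟨hF₁, hd₁, -, -⟩ := bInf_factorisation hc hw hr0 hfloor hshade (k := k + 1) (by omega)
  have hstep : c (k + 1) = CentreBlowup.step 5 Finset.univ (j k) (b k) (c k) := (hw k).2.2.2.2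
  refine ⟨?_, hd₁.symm.le⟩
  have hr₁ : (c (k + 1)).r = (((c k).r.filter fun i => b k i = 0)).update (j k) ((c k).r.degree + 3 - 5) := by
    rw [hlaw k hk]
    congr 1
  rw [← hstep, ← hr₁]
  exact hF₁

end Factorisation

/-! ## 3. Linear algebra of frames: explicit left inverses -/

section Frames

/-- **ARRIVAL INVERSE.**  If `M` is a left inverse of the rows `L` and the pivot row is `L piv = e_m`, then dropping the `m`-th
coefficient from every other row (the ARRIVAL frame of the Φ-line step laws) keeps a left inverse, namely
`M′ t i = if i = piv then δ_{t m} else M t i`. [OURS · linear algebra] [cite: CossartJannsenSaito2020, Def. 8.2] -/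
theorem arrival_left_inverse {L : Fin (2 + 2) → Fin 4 → K} {M : Fin 4 → Fin (2 + 2) → K}
    (hM : ∀ t u, ∑ i, M t i * L i u = if t = u then 1 else 0) {piv : Fin (2 + 2)} {m : Fin 4}
    (hpiv : L piv = Pi.single m 1) {L' : Fin (2 + 2) → Fin 4 → K} (hL'piv : L' piv = Pi.single m 1)
    (hL' : ∀ i, i ≠ piv → L' i = Function.update (L i) m 0) :
    ∀ t u, ∑ i, (if i = piv then (if t = m then (1 : K) else 0) else M t i) * L' i u = if t = u then 1 else 0 := by
  intro t u
  have hsplit : ∀ f : Fin (2 + 2) → K, ∑ i, f i = f piv + ∑ i ∈ Finset.univ.erase piv, f i := fun f =>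
    (Finset.add_sum_erase _ f (Finset.mem_univ piv)).symm
  rw [hsplit, if_pos rfl, hL'piv]
  have hrest : ∑ i ∈ Finset.univ.erase piv, (if i = piv then (if t = m then (1 : K) else 0) else M t i) * L' i u =
      ∑ i ∈ Finset.univ.erase piv, M t i * (if u = m then 0 else L i u) := by
    refine Finset.sum_congr rfl fun i hi => ?_
    have hip : i ≠ piv := Finset.ne_of_mem_erase hi
    rw [if_neg hip, hL' i hip, Function.update_apply]
  rw [hrest]
  have hfull := hM t u
  rw [hsplit, hpiv] at hfull
  by_cases hum : u = m
  · subst hum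
    rw [Pi.single_eq_same, mul_one]
    simp only [if_true, mul_zero, Finset.sum_const_zero, add_zero]
  · rw [Pi.single_eq_of_ne hum, mul_zero, zero_add]
    rw [Pi.single_eq_of_ne hum, mul_zero, zero_add] at hfull
    simp only [if_neg hum]
    exact hfull

/-- Coefficients of a linear form `v` in the basis given by the rows of `L`: `v = Σ_i (Σ_t v_t M_{t i}) · L_i` whenever
`M` is a left inverse of `L`. [folklore] -/
theorem eq_sum_coeff_mul_row {L : Fin (2 + 2) → Fin 4 → K} {M : Fin 4 → Fin (2 + 2) → K}
    (hM : ∀ t u, ∑ i, M t i * L i u = if t = u then 1 else 0) (v : Fin 4 → K) (u : Fin 4) :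
    v u = ∑ i, (∑ t, v t * M t i) * L i u := by
  have h : ∑ i, (∑ t, v t * M t i) * L i u = ∑ t, v t * ∑ i, M t i * L i u := by
    simp_rw [Finset.sum_mul, Finset.mul_sum, mul_assoc]
    rw [Finset.sum_comm]
  rw [h]
  simp_rw [hM]
  rw [Finset.sum_eq_single u (fun t _ htu => by rw [if_neg htu, mul_zero]) (fun h => absurd (Finset.mem_univ u) h),
    if_pos rfl, mul_one]

/-- **The pivot coefficient is non-zero**: if the rows other than `piv` all kill a vector `w` while `v·w ≠ 0`, then the
`piv`-coefficient of `v` in the row basis is non-zero (on a B∞ step: `w` = the direction, killed by the `y`-rows and by `e_h`,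
`v = e_m` with `w_m = 1`). [OURS · linear algebra] [cite: CossartJannsenSaito2020, Def. 8.2] -/
theorem coeff_replaceRow_ne_zero {L : Fin (2 + 2) → Fin 4 → K} {M : Fin 4 → Fin (2 + 2) → K}
    (hM : ∀ t u, ∑ i, M t i * L i u = if t = u then 1 else 0) {piv : Fin (2 + 2)} {v w : Fin 4 → K}
    (hkill : ∀ i, i ≠ piv → ∑ u, L i u * w u = 0) (hvw : ∑ u, v u * w u ≠ 0) :
    ∑ t, v t * M t piv ≠ 0 := by
  intro hzero
  apply hvw
  have h : ∑ u, v u * w u = ∑ i, (∑ t, v t * M t i) * ∑ u, L i u * w u := by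
    have : ∀ u, v u * w u = ∑ i, (∑ t, v t * M t i) * (L i u * w u) := fun u => by
      rw [eq_sum_coeff_mul_row hM v u, Finset.sum_mul]
      simp_rw [mul_assoc]
    simp_rw [this]
    rw [Finset.sum_comm]
    simp_rw [← Finset.mul_sum]
  rw [h, ← Finset.add_sum_erase _ _ (Finset.mem_univ piv), hzero, zero_mul, zero_add]
  exact Finset.sum_eq_zero fun i hi => by rw [hkill i (Finset.ne_of_mem_erase hi), mul_zero]

/-- **REPLACE-ROW INVERSE.**  Replacing the row `piv` of `L` by a linear form `v` whose `piv`-coefficient `a = Σ_t v_t M_{t piv}`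
in the row basis is non-zero keeps a left inverse, namely `M′ t i = if i = piv then M t piv · a⁻¹ else M t i − M t piv · a_i · a⁻¹`
(`a_i = Σ_t v_t M_{t i}`). [OURS · linear algebra] [cite: CossartJannsenSaito2020, Def. 8.2] -/
theorem replaceRow_left_inverse {L : Fin (2 + 2) → Fin 4 → K} {M : Fin 4 → Fin (2 + 2) → K}
    (hM : ∀ t u, ∑ i, M t i * L i u = if t = u then 1 else 0) (piv : Fin (2 + 2)) (v : Fin 4 → K)
    (ha : ∑ t, v t * M t piv ≠ 0) {S : Fin (2 + 2) → Fin 4 → K} (hSpiv : S piv = v) (hS : ∀ i, i ≠ piv → S i = L i) :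
    ∀ t u, ∑ i, (if i = piv then M t piv * (∑ t', v t' * M t' piv)⁻¹
        else M t i - M t piv * (∑ t', v t' * M t' i) * (∑ t', v t' * M t' piv)⁻¹) * S i u = if t = u then 1 else 0 := by
  intro t u
  set a : Fin (2 + 2) → K := fun i => ∑ t', v t' * M t' i with ha_def
  have hsplit : ∀ f : Fin (2 + 2) → K, ∑ i, f i = f piv + ∑ i ∈ Finset.univ.erase piv, f i := fun f =>
    (Finset.add_sum_erase _ f (Finset.mem_univ piv)).symm
  -- `v u = a piv * L piv u + Σ_{i ≠ piv} a i * L i u`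
  have hv : v u = a piv * L piv u + ∑ i ∈ Finset.univ.erase piv, a i * L i u := by
    rw [eq_sum_coeff_mul_row hM v u, hsplit]
  rw [hsplit, if_pos rfl, hSpiv]
  have hrest : ∑ i ∈ Finset.univ.erase piv,
      (if i = piv then M t piv * (a piv)⁻¹ else M t i - M t piv * a i * (a piv)⁻¹) * S i u =
      ∑ i ∈ Finset.univ.erase piv, M t i * L i u -
        M t piv * (a piv)⁻¹ * ∑ i ∈ Finset.univ.erase piv, a i * L i u := by
    rw [Finset.mul_sum, ← Finset.sum_sub_distrib]
    refine Finset.sum_congr rfl fun i hi => ?_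
    have hip : i ≠ piv := Finset.ne_of_mem_erase hi
    rw [if_neg hip, hS i hip]
    ring
  rw [hrest, hv]
  have hfull := hM t u
  rw [hsplit] at hfull
  have hainv : (a piv)⁻¹ * a piv = 1 := inv_mul_cancel₀ ha
  calc M t piv * (a piv)⁻¹ * (a piv * L piv u + ∑ i ∈ Finset.univ.erase piv, a i * L i u) +
        (∑ i ∈ Finset.univ.erase piv, M t i * L i u -
          M t piv * (a piv)⁻¹ * ∑ i ∈ Finset.univ.erase piv, a i * L i u)
      = M t piv * ((a piv)⁻¹ * a piv) * L piv u + ∑ i ∈ Finset.univ.erase piv, M t i * L i u := by ring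
    _ = if t = u then 1 else 0 := by rw [hainv, mul_one]; exact hfull

/-- **TWIST INVERSE** (`ũ₂ = u₂ − λ u₁`, CJS Lemma 13.6): replacing the row `q` by `L q − λ · L p` (`p ≠ q`) keeps a left
inverse, namely `M′ t i = M t i + (if i = p then λ · M t q else 0)`. [OURS · linear algebra]
[cite: CossartJannsenSaito2020, Lemma 13.6] -/
theorem twist_left_inverse {L : Fin (2 + 2) → Fin 4 → K} {M : Fin 4 → Fin (2 + 2) → K}
    (hM : ∀ t u, ∑ i, M t i * L i u = if t = u then 1 else 0) {p q : Fin (2 + 2)} (hpq : p ≠ q) (lam : K)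
    {S : Fin (2 + 2) → Fin 4 → K} (hSq : S q = L q - lam • L p) (hS : ∀ i, i ≠ q → S i = L i) :
    ∀ t u, ∑ i, (M t i + if i = p then lam * M t q else 0) * S i u = if t = u then 1 else 0 := by
  intro t u
  rw [← hM t u]
  -- split both sums at `q` and at `p`
  have hsplit : ∀ f : Fin (2 + 2) → K, ∑ i, f i = f q + (f p + ∑ i ∈ (Finset.univ.erase q).erase p, f i) := fun f => by
    rw [← Finset.add_sum_erase _ f (Finset.mem_univ q), ← Finset.add_sum_erase _ f
      (Finset.mem_erase.mpr ⟨hpq, Finset.mem_univ p⟩)]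
  rw [hsplit, hsplit (fun i => M t i * L i u), if_neg (Ne.symm hpq), if_pos rfl, hSq, hS p hpq]
  have hrest : ∑ i ∈ (Finset.univ.erase q).erase p, (M t i + if i = p then lam * M t q else 0) * S i u =
      ∑ i ∈ (Finset.univ.erase q).erase p, M t i * L i u := by
    refine Finset.sum_congr rfl fun i hi => ?_
    have hip : i ≠ p := Finset.ne_of_mem_erase hi
    have hiq : i ≠ q := Finset.ne_of_mem_erase (Finset.mem_of_mem_erase hi)
    rw [if_neg hip, add_zero, hS i hiq]
  rw [hrest, Pi.sub_apply, Pi.smul_apply, smul_eq_mul]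
  ring

end Frames

/-! ## 4. The frame read in `𝒪 = K[x]_{(x)}` -/

section FrameRows

/-- The row `e_h` reads `x_h/1` in `𝒪` (the `hu1` binder of `PhiLine.alphaS_lt_of_isIsolated`). [folklore] -/
theorem frameRow_single (h : Fin 4) :
    algebraMap (MvPolynomial (Fin 4) K) (OriginLocalization K 4) (∑ t, C ((Pi.single h 1 : Fin 4 → K) t) * X t) =
      algebraMap (MvPolynomial (Fin 4) K) (OriginLocalization K 4) (X h) := by
  rw [PhiLine.sum_C_single_mul_X]

/-- Linear forms are linear in their coefficient rows: `Σ C (a_t − λ b_t) x_t = Σ C a_t x_t − C λ · Σ C b_t x_t`. [folklore] -/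
theorem linearForm_sub_smul (a b : Fin 4 → K) (lam : K) :
    (∑ t, C ((a - lam • b) t) * X t : MvPolynomial (Fin 4) K) = ∑ t, C (a t) * X t - C lam * ∑ t, C (b t) * X t := by
  rw [Finset.mul_sum, ← Finset.sum_sub_distrib]
  refine Finset.sum_congr rfl fun t _ => ?_
  rw [Pi.sub_apply, Pi.smul_apply, smul_eq_mul, C_sub, C_mul]
  ring

/-- **The twisted frame is `u2Shear` of the old one**: if `S (u2 2) = L (u2 2) − λ · L (u1 2)` and `S i = L i` otherwise, then
in `𝒪` the frame of `S` is `WeightedOrder.u2Shear (frame of L) (−λ/1)` — so `…PhiLineFrameMoves.alphaS_/betaS_/deltaS_u2Shear`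
transport the polygon data. [OURS · bookkeeping] [cite: CossartJannsenSaito2020, Lemma 13.6] -/
theorem frameRow_twist {L S : Fin (2 + 2) → Fin 4 → K} (lam : K) (hSq : S (u2 2) = L (u2 2) - lam • L (u1 2))
    (hS : ∀ i, i ≠ u2 2 → S i = L i) :
    (fun i => algebraMap (MvPolynomial (Fin 4) K) (OriginLocalization K 4) (∑ t, C (S i t) * X t)) =
      u2Shear (fun i => algebraMap (MvPolynomial (Fin 4) K) (OriginLocalization K 4) (∑ t, C (L i t) * X t))
        (-algebraMap (MvPolynomial (Fin 4) K) (OriginLocalization K 4) (C lam)) := by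
  funext i
  by_cases hi : i = u2 2
  · subst hi
    rw [u2Shear_u2, hSq, linearForm_sub_smul, map_sub, map_mul]
    ring
  · rw [u2Shear_of_ne _ _ hi, hS i hi]

/-- The frame of rows `L` generates `𝔪_𝒪` as soon as `L` has a left inverse (re-export of
`PhiLine.span_range_linearFrame_eq_maximalIdeal` in the shape the stubs use). [folklore] -/
theorem span_range_frame_eq_maximalIdeal (L : Fin (2 + 2) → Fin 4 → K) (M : Fin 4 → Fin (2 + 2) → K)
    (hM : ∀ t u, ∑ i, M t i * L i u = if t = u then 1 else 0) :
    Ideal.span (Set.range fun i => algebraMap (MvPolynomial (Fin 4) K) (OriginLocalization K 4)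
      (∑ t, C (L i t) * X t)) = maximalIdeal (OriginLocalization K 4) :=
  PhiLine.span_range_linearFrame_eq_maximalIdeal L M hM

end FrameRows

end ResCone

end Summit.ResolutionOfSingularities.ResolutionOfSingularities.Theorems.PIDim4

end
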